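import Literature.NumberTheory.Sieve.SmoothNumbersAPSegment
import Literature.NumberTheory.Sieve.SmoothCanonicalPrefix
import Literature.NumberTheory.Sieve.SmoothMinorArcsResidues
import HarnessLib

/-!
# Large values of exponential sums over smooth numbers, IV: fairly major differences, the easy range

Topic `Literature/NumberTheory/Sieve`; a PROVED file toward
`Literature.NumberTheory.DiophantineGeometry.XYZUpperHalf` ([Harper2016, Cor. 1]). This is the
second ("easy") half of the proof of Proposition 4 of op. cit. (§4, p. 18): for `t = a/q + η₀`
with `(a, q) = 1` and `m` in the range `m |η₀| ≤ 1/(2q)` (Harper's `m ≤ M̃`), one has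
`‖m t‖ ≍ ‖b a/q‖` on the class `m ≡ b (mod q)`, `b ≠ 0`, and `‖m t‖ = m|η₀|` on the class `q ∣ m`;
counting the classes with Smooth Numbers Result 3 (`card_smooth_segment_modEq_le`) and the zero
class with the harmonic sum over smooth numbers (`sum_inv_smooth_Ioc_le`) gives

`sum_geomBound_prefix_easy_le`: with `W = x/(yK)`, `𝓜 = prefixSet y W`, `𝓟 = x^α ζ(α,y)/√φ₂(α,y)`,
`∑_{m ∈ 𝓜, m|η₀|q ≤ 1/2} min(x/m, 1/(2‖m t‖))
   ≤ C (1 + log y)² ((1 + log q) q^{1−α} K^{−α} y^{1−α} + (qyK)^{1−α}/(q(1 + |η₀|x))) 𝓟`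

(printed: `≪ q log q Ψ(x/K,y) q^{1−α} (log x)/q + (1/q) min{x, 1/|η|} ∑ 1/m'`, loc. cit.; we keep
the factors `y^{1−α}`, `q^{1−α}`, `(qyK)^{1−α}` symbolic — they are `(log x)^{O(1)}` in the ranges of
op. cit. by (2.1) there).

Tools proved here: a one-variable form of the residue splitting of §3 of op. cit.
(`sum_geomBound_residue_split_single`), `abs_le_distInt_of_abs_le_half`.

## References

* A. J. Harper, *Minor arcs, mean values, and restriction theory for exponential sums over smooth
  numbers*, Compositio Math. 152 (2016) 1121–1158, §4, Proposition 4 [Harper2016].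
-/

noncomputable section

open Finset Real
open Literature.NumberTheory.Sieve.Vinogradov

namespace Literature.NumberTheory.Sieve

/-! ### Small tools -/

/-- `|ε| ≤ ‖ε‖` when `|ε| ≤ 1/2` (so `‖ε‖ = |ε|`). [folklore] -/
theorem abs_le_distInt_of_abs_le_half {ε : ℝ} (h : |ε| ≤ 1 / 2) : |ε| ≤ distInt ε := by
  unfold distInt
  set n := round ε with hn
  rcases eq_or_ne n 0 with h0 | h0
  · simp [h0]
  · have h1 : (1 : ℝ) ≤ |(n : ℝ)| := by exact_mod_cast Int.one_le_abs h0
    have h2 : |(n : ℝ)| - |ε| ≤ |ε - n| := by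
      have := abs_sub_abs_le_abs_sub (n : ℝ) ε
      rw [abs_sub_comm] at this; linarith
    linarith

/-- For `0 < m`, `|m η₀| ≤ 1/2`, `0 < x`: `min(x/m, 1/(2‖mη₀‖)) ≤ (1/m) · 2x/(1 + |η₀| x)`.
[cite: Harper2016, §4, proof of Proposition 4 (the class `q ∣ m`)] -/
theorem geomBound_div_le_of_abs_le_half {x η₀ : ℝ} {m : ℕ} (hx : 0 < x) (hm : 0 < m)
    (h : |(m : ℝ) * η₀| ≤ 1 / 2) :
    geomBound (x / m) ((m : ℝ) * η₀) ≤ (1 / (m : ℝ)) * (2 * x / (1 + |η₀| * x)) := by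
  have hm0 : (0 : ℝ) < m := by exact_mod_cast hm
  have hden : 0 < 1 + |η₀| * x := by positivity
  rcases le_or_gt (|η₀| * x) 1 with hsmall | hlarge
  · -- `min ≤ x/m ≤ (1/m) 2x/(1+|η₀|x)`
    calc geomBound (x / m) ((m : ℝ) * η₀) ≤ x / m := geomBound_le _ _
      _ = (1 / (m : ℝ)) * x := by ring
      _ ≤ (1 / (m : ℝ)) * (2 * x / (1 + |η₀| * x)) := by
          apply mul_le_mul_of_nonneg_left _ (by positivity)
          rw [le_div_iff₀ hden]; nlinarith
  · -- `min ≤ 1/(2 m |η₀|) ≤ (1/m) · 2x/(1+|η₀|x)`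
    have hη : 0 < |η₀| := by
      rcases eq_or_lt_of_le (abs_nonneg η₀) with h0 | h0
      · rw [← h0, zero_mul] at hlarge; linarith
      · exact h0
    have hd : 0 < distInt ((m : ℝ) * η₀) := by
      have := abs_le_distInt_of_abs_le_half h
      have h2 : 0 < |(m : ℝ) * η₀| := by rw [abs_mul, abs_of_pos hm0]; positivity
      linarith
    calc geomBound (x / m) ((m : ℝ) * η₀) ≤ 1 / (2 * distInt ((m : ℝ) * η₀)) := geomBound_le_inv _ hd
      _ ≤ 1 / (2 * |(m : ℝ) * η₀|) := by
          apply one_div_le_one_div_of_le (by rw [abs_mul, abs_of_pos hm0]; positivity)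
          linarith [abs_le_distInt_of_abs_le_half h]
      _ = (1 / (m : ℝ)) * (1 / (2 * |η₀|)) := by rw [abs_mul, abs_of_pos hm0]; field_simp
      _ ≤ (1 / (m : ℝ)) * (2 * x / (1 + |η₀| * x)) := by
          apply mul_le_mul_of_nonneg_left _ (by positivity)
          rw [div_le_div_iff₀ (by positivity) hden]
          nlinarith

/-! ### Splitting by residues, one variable -/

/-- **Splitting by residues** (one-variable form of [Harper2016, §3, p. 12]). Let `r ≥ 1`,
`(a', r) = 1`, `S ⊆ ℕ` finite, `|ε(m)| ≤ 1/(2r)` on `S`, `V ≥ 0`, and suppose every nonzero class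
`{m ∈ S : m ≡ b (mod r)}`, `0 < b < r`, has at most `T` elements. Then
`∑_{m ∈ S} min(V(m), 1/(2‖a'm/r + ε(m)‖)) ≤ 2 T r (1 + log r) + ∑_{m ∈ S, r ∣ m} min(V(m), 1/(2‖ε(m)‖))`.
[cite: Harper2016, §3, p. 12 and §4, p. 18] -/
theorem sum_geomBound_residue_split_single (S : Finset ℕ) {r : ℕ} (hr : 0 < r) {a' : ℤ}
    (hcop : IsCoprime a' (r : ℤ)) (ε : ℕ → ℝ) (hε : ∀ m ∈ S, |ε m| ≤ 1 / (2 * (r : ℝ)))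
    (V : ℕ → ℝ) (hV : ∀ m, 0 ≤ V m) {T : ℝ} (hT0 : 0 ≤ T)
    (hT : ∀ b : ℕ, 0 < b → b < r → ((S.filter (fun m => m % r = b)).card : ℝ) ≤ T) :
    ∑ m ∈ S, geomBound (V m) ((a' : ℝ) * (m : ℝ) / r + ε m) ≤
      2 * T * r * (1 + Real.log r) + ∑ m ∈ S.filter (fun m => r ∣ m), geomBound (V m) (ε m) := by
  classical
  have hrr : (0 : ℝ) < r := by exact_mod_cast hr
  have hrz : (0 : ℤ) < r := by exact_mod_cast hr
  -- `‖a' n/r‖ ≥ 1/r` when `r ∤ n`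
  have hfar : ∀ n : ℤ, ¬ (r : ℤ) ∣ n → 1 / (r : ℝ) ≤ distInt ((a' : ℝ) * n / r) := by
    intro n hn
    have hn' : ¬ (r : ℤ) ∣ a' * n := fun h => hn (hcop.symm.dvd_of_dvd_mul_left h)
    unfold distInt
    set k := round ((a' : ℝ) * n / r) with hk
    have hne : a' * n - k * r ≠ 0 := fun h => hn' ⟨k, by linarith⟩
    have h1 : (1 : ℝ) ≤ |(((a' * n - k * r : ℤ)) : ℝ)| := by exact_mod_cast Int.one_le_abs hne
    have heq : (a' : ℝ) * n / r - k = (((a' * n - k * r : ℤ)) : ℝ) / r := by push_cast; field_simp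
    rw [heq, abs_div, abs_of_pos hrr]
    exact div_le_div_of_nonneg_right h1 hrr.le
  set G : ℕ → ℝ := fun m => geomBound (V m) ((a' : ℝ) * (m : ℝ) / r + ε m) with hG
  have hG0 : ∀ m, 0 ≤ G m := fun m => geomBound_nonneg (hV m) _
  set Z := S.filter (fun m => r ∣ m) with hZ
  set NZ := S.filter (fun m => ¬ r ∣ m) with hNZ
  have hsplit0 : ∑ m ∈ S, G m = ∑ m ∈ NZ, G m + ∑ m ∈ Z, G m := by
    rw [hZ, hNZ, add_comm]; exact (Finset.sum_filter_add_sum_filter_not S (fun m => r ∣ m) G).symm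
  rw [show ∑ m ∈ S, geomBound (V m) ((a' : ℝ) * (m : ℝ) / r + ε m) = ∑ m ∈ S, G m from rfl, hsplit0]
  refine add_le_add ?_ ?_
  · ------------------------------------------------------------------
    -- the nonzero classes
    set Rset := (Finset.range r).filter (fun b => b ≠ 0) with hRset
    have hmaps : ∀ m ∈ NZ, m % r ∈ Rset := by
      intro m hm
      rw [hNZ, Finset.mem_filter] at hm
      rw [hRset, Finset.mem_filter, Finset.mem_range]
      exact ⟨Nat.mod_lt _ hr, fun h0 => hm.2 (Nat.dvd_of_mod_eq_zero h0)⟩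
    rw [← Finset.sum_fiberwise_of_maps_to hmaps]
    have hfib : ∀ b ∈ Rset, ∑ m ∈ NZ.filter (fun m => m % r = b), G m ≤
        T * (1 / distInt ((a' : ℝ) * b / r)) := by
      intro b hb
      rw [hRset, Finset.mem_filter, Finset.mem_range] at hb
      obtain ⟨hbr, hb0⟩ := hb
      have hbnd : ¬ (r : ℤ) ∣ (b : ℤ) := by
        intro h
        have h1 : (r : ℤ) ≤ b := Int.le_of_dvd (by exact_mod_cast Nat.pos_of_ne_zero hb0) h
        have : r ≤ b := by exact_mod_cast h1
        omega
      have hsb : 1 / (r : ℝ) ≤ distInt ((a' : ℝ) * b / r) := by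
        have := hfar b hbnd; push_cast at this; exact this
      have hds : 0 < distInt ((a' : ℝ) * b / r) := lt_of_lt_of_le (by positivity) hsb
      have hpt : ∀ m ∈ NZ.filter (fun m => m % r = b), G m ≤ 1 / distInt ((a' : ℝ) * b / r) := by
        intro m hm
        rw [Finset.mem_filter] at hm
        obtain ⟨hmNZ, hmb⟩ := hm
        have hmS : m ∈ S := (Finset.mem_filter.mp hmNZ).1
        -- `m = b + r k`
        obtain ⟨k, hk⟩ : ∃ k : ℕ, m = b + r * k := ⟨m / r, by rw [← hmb]; exact (Nat.mod_add_div m r).symm⟩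
        have hsplit : (a' : ℝ) * (m : ℝ) / r + ε m = ((a' : ℝ) * b / r + ε m) + ((a' * k : ℤ) : ℝ) := by
          rw [hk]; push_cast; field_simp; ring
        simp only [hG]
        rw [hsplit, show geomBound (V m) ((a' : ℝ) * b / r + ε m + ((a' * k : ℤ) : ℝ)) =
          geomBound (V m) ((a' : ℝ) * b / r + ε m) by unfold geomBound; rw [distInt_add_int]]
        apply geomBound_le_inv_distInt (V m) hds
        calc |ε m| ≤ 1 / (2 * (r : ℝ)) := hε m hmS
          _ = (1 / (r : ℝ)) / 2 := by ring
          _ ≤ distInt ((a' : ℝ) * b / r) / 2 := by linarith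
      have hsub : NZ.filter (fun m => m % r = b) ⊆ S.filter (fun m => m % r = b) := by
        intro m hm
        rw [Finset.mem_filter] at hm ⊢
        exact ⟨(Finset.mem_filter.mp hm.1).1, hm.2⟩
      have hcard : ((NZ.filter (fun m => m % r = b)).card : ℝ) ≤ T :=
        le_trans (by exact_mod_cast Finset.card_le_card hsub) (hT b (Nat.pos_of_ne_zero hb0) hbr)
      calc ∑ m ∈ NZ.filter (fun m => m % r = b), G m
          ≤ ∑ m ∈ NZ.filter (fun m => m % r = b), (1 / distInt ((a' : ℝ) * b / r)) :=
            Finset.sum_le_sum hpt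
        _ = (NZ.filter (fun m => m % r = b)).card * (1 / distInt ((a' : ℝ) * b / r)) := by
            rw [Finset.sum_const, nsmul_eq_mul]
        _ ≤ T * (1 / distInt ((a' : ℝ) * b / r)) :=
            mul_le_mul_of_nonneg_right hcard (by positivity)
    -- the spacing sum
    have hsp : ∑ b ∈ Rset, 1 / (2 * distInt ((a' : ℝ) * b / r)) ≤
        (1 / (1 / (r : ℝ))) * (1 + Real.log r) := by
      apply sum_inv_distInt_le_of_separated Rset (fun b : ℕ => (a' : ℝ) * b / r) (δ := 1 / r)
        (by positivity) (m := r)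
      · rw [show (1 : ℝ) / (2 * (1 / r)) = r / 2 by field_simp]; linarith
      · intro i hi j hj hij
        rw [hRset, Finset.mem_filter, Finset.mem_range] at hi hj
        have hnd : ¬ (r : ℤ) ∣ ((i : ℤ) - j) := by
          intro h
          have hlt : |(i : ℤ) - j| < r := by rw [abs_lt]; constructor <;> omega
          have := Int.eq_zero_of_abs_lt_dvd h hlt
          omega
        have := hfar ((i : ℤ) - j) hnd
        push_cast at this
        rw [show (a' : ℝ) * i / r - (a' : ℝ) * j / r = (a' : ℝ) * ((i : ℝ) - j) / r by ring]
        exact this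
      · intro i hi
        rw [hRset, Finset.mem_filter, Finset.mem_range] at hi
        have hnd : ¬ (r : ℤ) ∣ (i : ℤ) := by
          intro h
          have h1 : (r : ℤ) ≤ i := Int.le_of_dvd (by exact_mod_cast Nat.pos_of_ne_zero hi.2) h
          have : r ≤ i := by exact_mod_cast h1
          omega
        have := hfar i hnd; push_cast at this; exact this
    rw [one_div_one_div] at hsp
    calc ∑ b ∈ Rset, ∑ m ∈ NZ.filter (fun m => m % r = b), G m
        ≤ ∑ b ∈ Rset, T * (1 / distInt ((a' : ℝ) * b / r)) := Finset.sum_le_sum hfib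
      _ = 2 * T * ∑ b ∈ Rset, 1 / (2 * distInt ((a' : ℝ) * b / r)) := by
          rw [Finset.mul_sum]
          refine Finset.sum_congr rfl fun b _ => ?_
          have : (2 : ℝ) ≠ 0 := by norm_num
          field_simp
      _ ≤ 2 * T * ((r : ℝ) * (1 + Real.log r)) := mul_le_mul_of_nonneg_left hsp (by positivity)
      _ = 2 * T * r * (1 + Real.log r) := by ring
  · ------------------------------------------------------------------
    -- the zero class: `a' m/r ∈ ℤ`
    refine le_of_eq (Finset.sum_congr rfl fun m hm => ?_)
    rw [hZ, Finset.mem_filter] at hm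
    obtain ⟨k, hk⟩ := hm.2
    simp only [hG]
    have hsplit : (a' : ℝ) * (m : ℝ) / r + ε m = ε m + ((a' * k : ℤ) : ℝ) := by
      rw [hk]; push_cast; field_simp; ring
    rw [hsplit]
    unfold geomBound; rw [distInt_add_int]

/-! ### The zero class: multiples of `q` -/

/-- Reindexing the multiples of `q` in `(W, Wy]`: `∑_{m ∈ E, q ∣ m} 1/m ≤ (1/q) ∑_{W/q < m' ≤ (W/q) y, m' ∈ S(y)} 1/m'`
for `E ⊆ {W < m ≤ Wy, m ∈ S(y)}`. [folklore] -/
theorem sum_inv_multiples_le {y q : ℕ} {W : ℝ} (hq : 0 < q) (hW : 0 ≤ W) (E : Finset ℕ)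
    (hE : ∀ m ∈ E, W < m ∧ (m : ℝ) ≤ W * y ∧ m ∈ Nat.smoothNumbers (y + 1) ∧ q ∣ m) :
    ∑ m ∈ E, (1 / (m : ℝ)) ≤
      (1 / (q : ℝ)) * ∑ m' ∈ (Finset.Ioc ⌊W / q⌋₊ ⌊W / q * y⌋₊).filter (· ∈ Nat.smoothNumbers (y + 1)),
        (1 / (m' : ℝ)) := by
  classical
  have hq0 : (0 : ℝ) < q := by exact_mod_cast hq
  have hdiv : ∀ m ∈ E, (m : ℝ) = q * ((m / q : ℕ) : ℝ) := by
    intro m hm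
    have := Nat.mul_div_cancel' (hE m hm).2.2.2
    exact_mod_cast this.symm
  have h1 : ∑ m ∈ E, (1 / (m : ℝ)) = (1 / (q : ℝ)) * ∑ m ∈ E, (1 / (((m / q : ℕ)) : ℝ)) := by
    rw [Finset.mul_sum]
    refine Finset.sum_congr rfl fun m hm => ?_
    rw [hdiv m hm]
    have hmq : (0 : ℝ) < ((m / q : ℕ) : ℝ) := by
      have hm0 : (0 : ℝ) < m := lt_of_le_of_lt hW (hE m hm).1
      rw [hdiv m hm] at hm0
      exact pos_of_mul_pos_right hm0 hq0.le
    field_simp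
  rw [h1]
  apply mul_le_mul_of_nonneg_left _ (by positivity)
  have hinj : Set.InjOn (fun m : ℕ => m / q) (E : Set ℕ) := by
    intro m₁ hm₁ m₂ hm₂ h
    have e1 := Nat.mul_div_cancel' (hE m₁ hm₁).2.2.2
    have e2 := Nat.mul_div_cancel' (hE m₂ hm₂).2.2.2
    have : q * (m₁ / q) = q * (m₂ / q) := by rw [show (fun m : ℕ => m / q) m₁ = m₁ / q from rfl] at h; rw [h]
    rw [e1, e2] at this; exact this
  rw [← Finset.sum_image (f := fun n : ℕ => 1 / (n : ℝ)) hinj]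
  apply Finset.sum_le_sum_of_subset_of_nonneg
  · intro n hn
    rw [Finset.mem_image] at hn
    obtain ⟨m, hm, rfl⟩ := hn
    obtain ⟨hWm, hmWy, hsm, hqm⟩ := hE m hm
    have hmr : (m : ℝ) = q * ((m / q : ℕ) : ℝ) := hdiv m hm
    rw [Finset.mem_filter, Finset.mem_Ioc]
    refine ⟨⟨?_, ?_⟩, Nat.mem_smoothNumbers_of_dvd hsm (Nat.div_dvd_of_dvd hqm)⟩
    · rw [Nat.floor_lt (by positivity)]
      rw [div_lt_iff₀ hq0]
      rw [hmr] at hWm; linarith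
    · apply Nat.le_floor
      rw [div_mul_eq_mul_div, le_div_iff₀ hq0]
      rw [hmr] at hmWy; linarith
  · intro n _ _; positivity

set_option maxHeartbeats 4000000 in
-- a long assembly
/-- **Fairly major differences, the easy range** (Harper, second half of the proof of
Proposition 4). See the module docstring. [cite: Harper2016, §4, Proposition 4 (p. 18)] -/
theorem sum_geomBound_prefix_easy_le :
    ∃ C x₀ : ℝ, 0 < C ∧ ∀ (x : ℝ) (y : ℕ), x₀ ≤ x → Real.log x ^ 4 ≤ y →
      Real.log y ≤ Real.log x ^ (1 / 6 : ℝ) → ∀ (K : ℕ), 1 ≤ K →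
      ∀ (q : ℕ), 1 ≤ q → 2 * (q : ℝ) ≤ x / (y * K) → ∀ (a : ℤ), IsCoprime a (q : ℤ) → ∀ (η₀ : ℝ),
        ∑ m ∈ (prefixSet y (x / (y * K))).filter (fun m : ℕ => (m : ℝ) * |η₀| * q ≤ 1 / 2),
            geomBound (x / m) ((m : ℝ) * ((a : ℝ) / q + η₀)) ≤
          C * (1 + Real.log y) ^ 2 *
            ((1 + Real.log q) * (q : ℝ) ^ (1 - saddlePoint x y) * (K : ℝ) ^ (-saddlePoint x y) *
                (y : ℝ) ^ (1 - saddlePoint x y) +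
              ((q : ℝ) * y * K) ^ (1 - saddlePoint x y) / ((q : ℝ) * (1 + |η₀| * x))) *
            (x ^ saddlePoint x y *
              (smoothZeta (saddlePoint x y) y / Real.sqrt (saddlePhi₂ (saddlePoint x y) y))) := by
  classical
  obtain ⟨C₃, x₀₃, hC₃, hS3⟩ := card_smooth_segment_modEq_le
  obtain ⟨C₂, x₀M, hC₂, hM⟩ := card_smoothNumbersUpTo_le_model_of_le
  obtain ⟨x₀1, hlt1⟩ := saddlePoint_lt_one
  refine ⟨2 * C₃ + 16 * C₂, max (max x₀₃ x₀M) (max x₀1 (Real.exp 4)), by positivity,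
    fun x y hx hy4 hy6 K hK1 q hq1 hqW a hcop η₀ => ?_⟩
  have hx₀₃ : x₀₃ ≤ x := le_trans ((le_max_left _ _).trans (le_max_left _ _)) hx
  have hx₀M : x₀M ≤ x := le_trans ((le_max_right _ _).trans (le_max_left _ _)) hx
  have hx₀1 : x₀1 ≤ x := le_trans ((le_max_left _ _).trans (le_max_right _ _)) hx
  have hxe : Real.exp 4 ≤ x := le_trans ((le_max_right _ _).trans (le_max_right _ _)) hx
  ------------------------------------------------------------------
  -- ### the range
  set Lx := Real.log x with hLx
  have hLx4 : 4 ≤ Lx := by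
    have := Real.log_le_log (Real.exp_pos _) hxe; rwa [Real.log_exp] at this
  have hx1 : 1 < x := by
    have : (1 : ℝ) < Real.exp 4 := by have := Real.add_one_le_exp (4 : ℝ); linarith
    exact lt_of_lt_of_le this hxe
  have hx0 : 0 < x := by linarith
  have hLx1 : 1 ≤ Lx := by linarith
  have hy256 : (256 : ℝ) ≤ y := by
    have : (4 : ℝ) ^ 4 ≤ Lx ^ 4 := pow_le_pow_left₀ (by norm_num) hLx4 4
    norm_num at this; linarith
  have hy1 : (1 : ℝ) ≤ y := by linarith
  have hy0 : (0 : ℝ) < y := by linarith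
  have hy2 : 2 ≤ y := by exact_mod_cast (show (2 : ℝ) ≤ y by linarith)
  have hy2r : (2 : ℝ) ≤ y := by exact_mod_cast hy2
  have hlogy0 : 0 ≤ Real.log y := Real.log_nonneg hy1
  have hlogy : Real.log y ≤ Lx := by
    refine hy6.trans ?_
    calc Real.log x ^ (1 / 6 : ℝ) ≤ Real.log x ^ (1 : ℝ) := Real.rpow_le_rpow_of_exponent_le hLx1 (by norm_num)
      _ = Lx := by rw [Real.rpow_one]
  have hyx : (y : ℝ) ≤ x := by
    rw [← Real.exp_log hy0, ← Real.exp_log hx0]; exact Real.exp_le_exp.mpr hlogy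
  have hK1r : (1 : ℝ) ≤ K := by exact_mod_cast hK1
  have hK0 : (0 : ℝ) < K := by linarith
  have hq0 : (0 : ℝ) < q := by exact_mod_cast hq1
  have hq1r : (1 : ℝ) ≤ q := by exact_mod_cast hq1
  have hq : 0 < q := hq1
  set α := saddlePoint x y with hαdef
  have hα0 : 0 < α := by rw [hαdef]; exact saddlePoint_pos hx1 hy2
  have hα1 : α ≤ 1 := by
    have hy3 : Real.log x ^ 3 ≤ y := by
      calc Real.log x ^ 3 ≤ Real.log x ^ 4 := pow_le_pow_right₀ hLx1 (by norm_num)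
        _ ≤ y := hy4
    exact (hlt1 x y hx₀1 hy3 hyx hy6).le
  set ζt := smoothZeta α y / Real.sqrt (saddlePhi₂ α y) with hζt
  have hζt0 : 0 ≤ ζt := div_nonneg (smoothZeta_pos hα0).le (Real.sqrt_nonneg _)
  set 𝓟 := x ^ α * ζt with h𝓟
  have h𝓟0 : 0 ≤ 𝓟 := by positivity
  -- `C₂ ζ̃ ≥ 1` (from `Ψ(1, y) = 1`)
  have hC₂ζ : 1 ≤ C₂ * ζt := by
    have h1 := hM x y hx₀M hy4 hy6 1 le_rfl hx1.le
    rw [← hαdef, Real.one_rpow, Nat.floor_one] at h1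
    have hone : 1 ∈ Nat.smoothNumbersUpTo 1 (y + 1) := by
      rw [Nat.mem_smoothNumbersUpTo]
      refine ⟨le_rfl, ?_⟩
      rw [Nat.mem_smoothNumbers]; exact ⟨one_ne_zero, fun p hp => by simp at hp⟩
    have hcard : (1 : ℝ) ≤ (Nat.smoothNumbersUpTo 1 (y + 1)).card := by
      exact_mod_cast Finset.one_le_card.mpr ⟨1, hone⟩
    calc (1 : ℝ) ≤ (Nat.smoothNumbersUpTo 1 (y + 1)).card := hcard
      _ ≤ C₂ * (1 * smoothZeta α y / Real.sqrt (saddlePhi₂ α y)) := h1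
      _ = C₂ * ζt := by rw [hζt]; ring
  ------------------------------------------------------------------
  -- ### `W`, the set `E`
  set W := x / (y * K) with hW
  have hyK0 : (0 : ℝ) < y * K := by positivity
  have hW0 : 0 < W := by positivity
  have hW2q : 2 * (q : ℝ) ≤ W := hqW
  have hWy : W * y = x / K := by rw [hW]; field_simp
  have hWyx : W * y ≤ x := by rw [hWy]; exact div_le_self hx0.le hK1r
  set E := (prefixSet y W).filter (fun m : ℕ => (m : ℝ) * |η₀| * q ≤ 1 / 2) with hE
  have hEmem : ∀ m ∈ E, W < m ∧ (m : ℝ) ≤ W * y ∧ m ∈ Nat.smoothNumbers (y + 1) ∧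
      (m : ℝ) * |η₀| * q ≤ 1 / 2 := by
    intro m hm
    rw [hE, Finset.mem_filter, mem_prefixSet hW0.le] at hm
    exact ⟨hm.1.1, hm.1.2.1, hm.1.2.2.1, hm.2⟩
  have hEε : ∀ m ∈ E, |(m : ℝ) * η₀| ≤ 1 / (2 * (q : ℝ)) := by
    intro m hm
    have h := (hEmem m hm).2.2.2
    rw [abs_mul, Nat.abs_cast, le_div_iff₀ (by positivity)]
    linarith
  ------------------------------------------------------------------
  -- ### the residue splitting
  set Z := W * y - W with hZ
  have hZq : (q : ℝ) * y ≤ Z := by rw [hZ]; nlinarith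
  have hWZ : W + Z = W * y := by rw [hZ]; ring
  set T := C₃ * Real.log y * (Z / q) ^ α * (y : ℝ) ^ (1 - α) * ζt with hT
  have hZ0 : 0 ≤ Z := by rw [hZ]; nlinarith
  have hT0 : 0 ≤ T := by positivity
  have hTb : ∀ b : ℕ, 0 < b → b < q → ((E.filter (fun m => m % q = b)).card : ℝ) ≤ T := by
    intro b hb0 hbq
    have h1 := hS3 x y hx₀₃ hy4 hy6 q hq b W Z hW0.le hZq (by rw [hWZ]; exact hWyx)
    rw [← hαdef, hWZ] at h1
    refine le_trans ?_ (h1.trans_eq (by rw [hT, hζt]))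
    have hsub : E.filter (fun m => m % q = b) ⊆
        (Finset.Ioc ⌊W⌋₊ ⌊W * y⌋₊).filter (fun n => n ≡ b [MOD q] ∧ n ∈ Nat.smoothNumbers (y + 1)) := by
      intro m hm
      rw [Finset.mem_filter] at hm
      obtain ⟨hmE, hmb⟩ := hm
      obtain ⟨hWm, hmWy, hsm, -⟩ := hEmem m hmE
      rw [Finset.mem_filter, Finset.mem_Ioc]
      refine ⟨⟨(Nat.floor_lt hW0.le).mpr hWm, Nat.le_floor hmWy⟩, ?_, hsm⟩
      rw [Nat.ModEq, hmb, Nat.mod_eq_of_lt hbq]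
    exact_mod_cast Finset.card_le_card hsub
  have hsplit := sum_geomBound_residue_split_single E hq hcop (fun m => (m : ℝ) * η₀) hEε
    (fun m => x / m) (fun m => by positivity) hT0 hTb
  -- rewrite the phase
  have hphase : ∑ m ∈ E, geomBound (x / m) ((m : ℝ) * ((a : ℝ) / q + η₀)) =
      ∑ m ∈ E, geomBound (x / m) ((a : ℝ) * (m : ℝ) / q + (m : ℝ) * η₀) := by
    refine Finset.sum_congr rfl fun m _ => ?_
    congr 1; ring
  rw [hphase]
  refine hsplit.trans ?_
  ------------------------------------------------------------------
  -- ### the first term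
  have hZle : Z / q ≤ x / K / q := by
    apply div_le_div_of_nonneg_right _ hq0.le
    rw [← hWy, hZ]; linarith
  have hterm1 : 2 * T * q * (1 + Real.log q) ≤
      2 * C₃ * (1 + Real.log y) ^ 2 * ((1 + Real.log q) * (q : ℝ) ^ (1 - α) * (K : ℝ) ^ (-α) *
        (y : ℝ) ^ (1 - α)) * 𝓟 := by
    have h1 : (Z / q) ^ α ≤ (x / K / q) ^ α := Real.rpow_le_rpow (by positivity) hZle hα0.le
    have h2 : (x / K / q) ^ α = x ^ α * (K : ℝ) ^ (-α) * (q : ℝ) ^ (-α) := by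
      rw [Real.div_rpow (by positivity) hq0.le, Real.div_rpow hx0.le hK0.le, Real.rpow_neg hK0.le,
        Real.rpow_neg hq0.le]
      field_simp
    have h3 : (q : ℝ) * (q : ℝ) ^ (-α) = (q : ℝ) ^ (1 - α) := by
      rw [show (1 : ℝ) - α = 1 + -α by ring, Real.rpow_add hq0, Real.rpow_one]
    have hlogq : 0 ≤ Real.log q := Real.log_nonneg hq1r
    have hly : Real.log y ≤ (1 + Real.log y) ^ 2 := by nlinarith
    calc 2 * T * q * (1 + Real.log q)
        = 2 * C₃ * Real.log y * ((Z / q) ^ α) * (y : ℝ) ^ (1 - α) * ζt * q * (1 + Real.log q) := by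
          rw [hT]; ring
      _ ≤ 2 * C₃ * (1 + Real.log y) ^ 2 * ((x / K / q) ^ α) * (y : ℝ) ^ (1 - α) * ζt * q *
            (1 + Real.log q) := by gcongr
      _ = 2 * C₃ * (1 + Real.log y) ^ 2 * ((1 + Real.log q) * ((q : ℝ) * (q : ℝ) ^ (-α)) *
            (K : ℝ) ^ (-α) * (y : ℝ) ^ (1 - α)) * (x ^ α * ζt) := by rw [h2]; ring
      _ = _ := by rw [h3, h𝓟]
  ------------------------------------------------------------------
  -- ### the zero class
  set E0 := E.filter (fun m => q ∣ m) with hE0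
  set L : ℝ := 2 * x / (1 + |η₀| * x) with hL
  have hL0 : 0 ≤ L := by positivity
  have hpt : ∀ m ∈ E0, geomBound (x / m) ((m : ℝ) * η₀) ≤ (1 / (m : ℝ)) * L := by
    intro m hm
    rw [hE0, Finset.mem_filter] at hm
    obtain ⟨hWm, -, -, hsmall⟩ := hEmem m hm.1
    have hm0 : 0 < m := by
      have : (0 : ℝ) < m := lt_trans hW0 hWm
      exact_mod_cast this
    apply geomBound_div_le_of_abs_le_half hx0 hm0
    have := hEε m hm.1
    calc |(m : ℝ) * η₀| ≤ 1 / (2 * (q : ℝ)) := this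
      _ ≤ 1 / 2 := by apply one_div_le_one_div_of_le (by norm_num); linarith
  set U := W / q with hU
  have hU0 : 0 < U := by positivity
  have hE0mem : ∀ m ∈ E0, W < m ∧ (m : ℝ) ≤ W * y ∧ m ∈ Nat.smoothNumbers (y + 1) ∧ q ∣ m := by
    intro m hm
    rw [hE0, Finset.mem_filter] at hm
    obtain ⟨hWm, hmWy, hsm, -⟩ := hEmem m hm.1
    exact ⟨hWm, hmWy, hsm, hm.2⟩
  have hmult := sum_inv_multiples_le (y := y) hq hW0.le E0 hE0mem
  rw [← hU] at hmult
  -- the harmonic sum over smooth numbers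
  set B := C₂ * ζt * (1 + Real.log y) with hB
  have hB1 : 1 + Real.log y ≤ B := by
    rw [hB]; nlinarith
  have hΨ : ∀ x' : ℝ, 1 ≤ x' → x' ≤ x →
      ((Nat.smoothNumbersUpTo ⌊x'⌋₊ (y + 1)).card : ℝ) ≤ B * x' ^ α := by
    intro x' hx'1 hx'x
    have h1 := hM x y hx₀M hy4 hy6 x' hx'1 hx'x
    rw [← hαdef] at h1
    calc ((Nat.smoothNumbersUpTo ⌊x'⌋₊ (y + 1)).card : ℝ) ≤ C₂ * (x' ^ α * smoothZeta α y / Real.sqrt (saddlePhi₂ α y)) := h1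
      _ = (C₂ * ζt) * 1 * x' ^ α := by rw [hζt]; ring
      _ ≤ (C₂ * ζt) * (1 + Real.log y) * x' ^ α := by gcongr; linarith
      _ = B * x' ^ α := by rw [hB]
  have hUX : U * y ≤ x := by
    rw [hU]
    calc W / q * y = W * y / q := by ring
      _ ≤ W * y := div_le_self (by positivity) hq1r
      _ ≤ x := hWyx
  have hharm := sum_inv_smooth_Ioc_le (X := x) (B := B) hy2 hα0 hα1 hU0 hUX hB1 hΨ
  have hzero : ∑ m ∈ E0, geomBound (x / m) ((m : ℝ) * η₀) ≤
      16 * C₂ * (1 + Real.log y) ^ 2 * (((q : ℝ) * y * K) ^ (1 - α) / ((q : ℝ) * (1 + |η₀| * x))) * 𝓟 := by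
    have h1 : ∑ m ∈ E0, geomBound (x / m) ((m : ℝ) * η₀) ≤ L * ∑ m ∈ E0, (1 / (m : ℝ)) := by
      rw [Finset.mul_sum]
      refine Finset.sum_le_sum fun m hm => ?_
      exact (hpt m hm).trans_eq (mul_comm _ _)
    have h2 : ∑ m ∈ E0, (1 / (m : ℝ)) ≤ (1 / (q : ℝ)) * (4 * B * (Real.log y / Real.log 2 + 2) * U ^ (α - 1)) :=
      hmult.trans (mul_le_mul_of_nonneg_left hharm (by positivity))
    -- `U^{α-1} = x^{α-1} (qyK)^{1-α}`
    have hUpow : U ^ (α - 1) = x ^ (α - 1) * ((q : ℝ) * y * K) ^ (1 - α) := by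
      have hUeq : U = x / ((q : ℝ) * y * K) := by rw [hU, hW]; field_simp
      rw [hUeq, Real.div_rpow hx0.le (by positivity), show (α - 1) = -(1 - α) by ring,
        Real.rpow_neg (by positivity : (0 : ℝ) ≤ (q : ℝ) * y * K), Real.rpow_neg hx0.le]
      field_simp
    have hlog2 : Real.log y / Real.log 2 + 2 ≤ 2 * (1 + Real.log y) := by
      have hl2 : (1 : ℝ) / 2 < Real.log 2 := by have := Real.log_two_gt_d9; linarith
      have : Real.log y / Real.log 2 ≤ 2 * Real.log y := by
        rw [div_le_iff₀ (by linarith)]; nlinarith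
      linarith
    have hxpow : x * x ^ (α - 1) = x ^ α := by
      rw [Real.rpow_sub_one hx0.ne']; field_simp
    calc ∑ m ∈ E0, geomBound (x / m) ((m : ℝ) * η₀)
        ≤ L * ((1 / (q : ℝ)) * (4 * B * (Real.log y / Real.log 2 + 2) * U ^ (α - 1))) :=
          h1.trans (mul_le_mul_of_nonneg_left h2 hL0)
      _ ≤ L * ((1 / (q : ℝ)) * (4 * B * (2 * (1 + Real.log y)) * U ^ (α - 1))) := by gcongr
      _ = 16 * (C₂ * ζt) * (1 + Real.log y) ^ 2 * (x * x ^ (α - 1)) *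
            (((q : ℝ) * y * K) ^ (1 - α) / ((q : ℝ) * (1 + |η₀| * x))) := by
          rw [hUpow, hB, hL]; field_simp; ring
      _ = 16 * C₂ * (1 + Real.log y) ^ 2 * (((q : ℝ) * y * K) ^ (1 - α) / ((q : ℝ) * (1 + |η₀| * x))) * 𝓟 := by
          rw [hxpow, h𝓟]; ring
  ------------------------------------------------------------------
  -- ### combine
  have hA0 : 0 ≤ (1 + Real.log q) * (q : ℝ) ^ (1 - α) * (K : ℝ) ^ (-α) * (y : ℝ) ^ (1 - α) := by
    have : 0 ≤ Real.log q := Real.log_nonneg hq1r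
    positivity
  have hB0 : 0 ≤ ((q : ℝ) * y * K) ^ (1 - α) / ((q : ℝ) * (1 + |η₀| * x)) := by positivity
  calc 2 * T * q * (1 + Real.log q) + ∑ m ∈ E0, geomBound (x / m) ((m : ℝ) * η₀)
      ≤ 2 * C₃ * (1 + Real.log y) ^ 2 * ((1 + Real.log q) * (q : ℝ) ^ (1 - α) * (K : ℝ) ^ (-α) *
          (y : ℝ) ^ (1 - α)) * 𝓟 +
        16 * C₂ * (1 + Real.log y) ^ 2 * (((q : ℝ) * y * K) ^ (1 - α) / ((q : ℝ) * (1 + |η₀| * x))) * 𝓟 :=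
        add_le_add hterm1 hzero
    _ ≤ (2 * C₃ + 16 * C₂) * (1 + Real.log y) ^ 2 * ((1 + Real.log q) * (q : ℝ) ^ (1 - α) * (K : ℝ) ^ (-α) *
          (y : ℝ) ^ (1 - α)) * 𝓟 +
        (2 * C₃ + 16 * C₂) * (1 + Real.log y) ^ 2 * (((q : ℝ) * y * K) ^ (1 - α) / ((q : ℝ) * (1 + |η₀| * x))) * 𝓟 := by
        have hl : 0 ≤ (1 + Real.log y) ^ 2 := by positivity
        apply add_le_add
        · apply mul_le_mul_of_nonneg_right _ h𝓟0
          apply mul_le_mul_of_nonneg_right _ hA0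
          apply mul_le_mul_of_nonneg_right _ hl
          linarith
        · apply mul_le_mul_of_nonneg_right _ h𝓟0
          apply mul_le_mul_of_nonneg_right _ hB0
          apply mul_le_mul_of_nonneg_right _ hl
          linarith
    _ = _ := by rw [h𝓟, hζt]; ring

end Literature.NumberTheory.Sieve

end
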